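import Summits.AtomisticToContinuum.FouriersLaw.Theorems.OddSectorIrreversibilityResponseDensityAssembly
import Summits.AtomisticToContinuum.FouriersLaw.Theorems.OddSectorIrreversibilityResponseDensityDetailedBalance

/-!
# `ResponseDensity` from the uniform mixing hypothesis alone

Item stmt-AtomisticToContinuum-9144 (`ResponseDensity`, route `OddSectorIrreversibility`, sub-problem
`FouriersLaw` of `AtomisticToContinuum`): the conditional reduction of `…Assembly.lean` with the
detailed-balance input `hDUAL` DISCHARGED (`pinnedChain_hDUAL`, `…DetailedBalance.lean`). What remains
is the single analytic input

* `hUM` — the exponential convergence (2.5) of the transition semigroups with baths at `T ± δ/2`,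
  with constants UNIFORM in `|δ| < δ₀` (a uniform Harris bound near equilibrium),

a binder, not a named fact:

* `responseDensity_conclusion_of_uniformMixing` — the conclusion of `ResponseDensity` at `(T, N)`,
  `N ≥ 1`, from the item's uniqueness hypothesis and `hUM`;
* `responseDensity_of_uniformMixing` — **`(∀ parameters, T, N ≥ 1, ∃ δ₀ ϑ C_m c, hUM) → ResponseDensity`**.

No definitions.
-/

noncomputable section

open MeasureTheory ProbabilityTheory Filter Topology Set
open scoped NNReal ENNReal ContDiff

namespace Summit.AtomisticToContinuum.FouriersLaw.Theorems

open Literature.MathematicalPhysics.KineticTheory.HeatConduction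
open Literature.Probability.Process Literature.MathematicalPhysics.KineticTheory OscillatorChain

variable {N : ℕ}

section Main

variable {ω₂ lam β γ : ℝ} (hω : 0 < ω₂) (hl : 0 ≤ lam) (hβ : 0 < β) (hγ : 0 < γ) (hN : 0 < N)
  {T : ℝ} (hT : 0 < T) {δ₀ : ℝ} (hδ₀ : 0 < δ₀) (hδ₀T : δ₀ < 2 * T)
  {ϑ : ℝ} (hϑ : 0 < ϑ) (hϑT : ϑ < 1 / (T + δ₀ / 2)) (h2ϑ : 2 * ϑ < 1 / T)
include hω hl hβ hγ hN hT hδ₀ hδ₀T hϑ hϑT h2ϑ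

/-- **`ResponseDensity` at `(T, N)` from uniform mixing.** For the pinned chain (`ω₂, β, γ > 0`,
`lam ≥ 0`, `N ≥ 1`, `T > 0`), under uniqueness of the weak steady states at this `N`, for every steady
family `μ`: if (2.5) holds with constants uniform for baths at `T ± δ/2`, `|δ| < δ₀` (`hUM`, with
`0 < δ₀ < 2T`, `0 < ϑ < 1/(T + δ₀/2)`, `2ϑ < 1/T`), then there is `h ∈ L²(μ T T)` representing the
`δ`-derivative at `0` of `δ ↦ ∫ F dμ_{T+δ/2,T-δ/2}` for all `F ∈ C_c^∞` and for each bond current. -/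
theorem responseDensity_conclusion_of_uniformMixing
    (huniq : ∀ (T_L T_R : ℝ), 0 < T_L → 0 < T_R → ∀ μ ν : Measure (PhaseSpace N),
      (pinnedChain ω₂ lam β γ).IsSteadyState N T_L T_R μ →
      (pinnedChain ω₂ lam β γ).IsSteadyState N T_L T_R ν → μ = ν)
    (μ : ℝ → ℝ → Measure (PhaseSpace N))
    (hμ : ∀ T_L T_R : ℝ, 0 < T_L → 0 < T_R → (pinnedChain ω₂ lam β γ).IsSteadyState N T_L T_R (μ T_L T_R))
    {Cm c : ℝ} (hCm : 0 ≤ Cm) (hc : 0 < c)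
    (hUM : ∀ δ : ℝ, |δ| < δ₀ → ∀ ν : Measure (PhaseSpace N), IsProbabilityMeasure ν →
      (∀ t : ℝ≥0, ν.bind ((pinnedChain ω₂ lam β γ).transitionKernel N (T + δ / 2) (T - δ / 2) t) = ν) →
      ∀ (z : PhaseSpace N) (t : ℝ≥0) (f : PhaseSpace N → ℝ), Continuous f →
        (∀ y, |f y| ≤ Real.exp (ϑ * (pinnedChain ω₂ lam β γ).hamiltonian N y)) →
        |(∫ y, f y ∂((pinnedChain ω₂ lam β γ).transitionKernel N (T + δ / 2) (T - δ / 2) t z)) -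
            ∫ y, f y ∂ν| ≤
          Cm * Real.exp (ϑ * (pinnedChain ω₂ lam β γ).hamiltonian N z) * Real.exp (-c * t)) :
    ∃ h : PhaseSpace N → ℝ, MemLp h 2 (μ T T) ∧
      (∀ F : PhaseSpace N → ℝ, ContDiff ℝ ((⊤ : ℕ∞) : WithTop ℕ∞) F → HasCompactSupport F →
        Tendsto (fun δ : ℝ => ((∫ x, F x ∂(μ (T + δ / 2) (T - δ / 2))) - ∫ x, F x ∂(μ T T)) / δ)
          (𝓝[≠] 0) (𝓝 (∫ x, F x * h x ∂(μ T T)))) ∧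
      (∀ i : Fin N, Tendsto (fun δ : ℝ =>
          ((∫ x, (pinnedChain ω₂ lam β γ).bondCurrent N i x ∂(μ (T + δ / 2) (T - δ / 2))) -
            ∫ x, (pinnedChain ω₂ lam β γ).bondCurrent N i x ∂(μ T T)) / δ)
          (𝓝[≠] 0) (𝓝 (∫ x, (pinnedChain ω₂ lam β γ).bondCurrent N i x * h x ∂(μ T T)))) :=
  responseDensity_conclusion_of_hyps hω hl hβ hγ hN hT hδ₀ hδ₀T hϑ hϑT h2ϑ huniq μ hμ hCm hc hUM
    (pinnedChain_hDUAL hω hl hβ.le hγ hN hT hϑ h2ϑ)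

end Main

/-- **`ResponseDensity` from uniform mixing at every `(T, N)`.** If for all admissible parameters,
every `T > 0` and every `N ≥ 1` there are `δ₀, ϑ, C_m, c` with `0 < δ₀ < 2T`, `0 < ϑ < 1/(T + δ₀/2)`,
`2ϑ < 1/T`, `C_m ≥ 0`, `c > 0` such that the exponential convergence (2.5) holds for the kernels with
baths at `T ± δ/2` with these constants for all `|δ| < δ₀` (`hUM`), then `ResponseDensity` holds. -/
theorem responseDensity_of_uniformMixing
    (H : ∀ ω₂ lam β γ : ℝ, 0 < ω₂ → 0 < lam → 0 < β → 0 < γ → ∀ T : ℝ, 0 < T → ∀ N : ℕ, 0 < N →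
      ∃ (δ₀ ϑ Cm c : ℝ), 0 < δ₀ ∧ δ₀ < 2 * T ∧ 0 < ϑ ∧ ϑ < 1 / (T + δ₀ / 2) ∧ 2 * ϑ < 1 / T ∧
        0 ≤ Cm ∧ 0 < c ∧
        (∀ δ : ℝ, |δ| < δ₀ → ∀ ν : Measure (PhaseSpace N), IsProbabilityMeasure ν →
          (∀ t : ℝ≥0, ν.bind ((pinnedChain ω₂ lam β γ).transitionKernel N (T + δ / 2) (T - δ / 2) t) = ν) →
          ∀ (z : PhaseSpace N) (t : ℝ≥0) (f : PhaseSpace N → ℝ), Continuous f →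
            (∀ y, |f y| ≤ Real.exp (ϑ * (pinnedChain ω₂ lam β γ).hamiltonian N y)) →
            |(∫ y, f y ∂((pinnedChain ω₂ lam β γ).transitionKernel N (T + δ / 2) (T - δ / 2) t z)) -
                ∫ y, f y ∂ν| ≤
              Cm * Real.exp (ϑ * (pinnedChain ω₂ lam β γ).hamiltonian N z) * Real.exp (-c * t))) :
    Summit.AtomisticToContinuum.FouriersLaw.Theses.OddSectorIrreversibility.ResponseDensity := by
  intro ω₂ lam β γ hω hl hβ hγ huniq μ hμ T hT N
  rcases Nat.eq_zero_or_pos N with rfl | hN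
  · exact responseDensity_conclusion_of_le_one (pinnedChain ω₂ lam β γ) zero_le_one hT
      (huniq 0 T T hT hT) (μ 0) (hμ 0)
  · obtain ⟨δ₀, ϑ, Cm, c, hδ₀, hδ₀T, hϑ, hϑT, h2ϑ, hCm, hc, hUM⟩ := H ω₂ lam β γ hω hl hβ hγ T hT N hN
    exact responseDensity_conclusion_of_uniformMixing hω hl.le hβ hγ hN hT hδ₀ hδ₀T hϑ hϑT h2ϑ (huniq N) (μ N)
      (hμ N) hCm hc hUM

end Summit.AtomisticToContinuum.FouriersLaw.Theorems

end
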